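import Literature.NumberTheory.EllipticCurves.Rank1Residual.Typed.X6
import Literature.NumberTheory.EllipticCurves.Rank1Residual.Typed.X7
import Literature.NumberTheory.EllipticCurves.Rank1Residual.Typed.X8
import Literature.NumberTheory.EllipticCurves.MatarNekovar2019.ShaVanishing
import HarnessLib

/-!
# Good supersingular classes X6 / X7 / X8: the PER-PAIR certificate route through Matar–Nekovář 2019 Thm. 6.7 (1), with `irr(p)` DISCHARGED by the class (Serre 1972 Prop. 12)

HONEST FRAMING (cell `b2b-bsdres`, run/shared/lean/b2b/bsd-rank1-residual/, verbatim in every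
file): the goal of the cell is to DELETE the COMBINATION-SHAPED residual classes of the
Birch–Swinnerton-Dyer formula for ALL analytic-rank `≤ 1` elliptic curves over `ℚ` — "full BSD
formula for every rank `≤ 1` curve in class `C`" assembled STRICTLY from published theorems — so
that the rank-`≤ 1` remainder becomes exactly the CONSTRUCTION-SHAPED classes, which are TYPED
(missing-input `Prop`s), NOT attempted. This is not "finishing BSD". Harvest seat 1 (census owner
of X6 / X7 / X8; prover owners TBD, CLASS-OWNERS "PAIR WANTED"), generation 13: bookkeeping of a
BOOKING SHAPE for the referee's admissibility ruling on Matar–Nekovář 2019 (lit g12,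
`HOME/b2b-bsdres-lit/g12/MN19-READING.md`; CLASS-OWNERS rows X7 / X8: "MN19 per-pair route …
pending admissibility"). Theorems only (compositions of tree theorems BY NAME); no definition, no
named fact; X6, X7, X8 REMAIN CONSTRUCTION-SHAPED; nothing is booked; PER PAIR.

## What this file records

`Typed.bsdp_of_matarNekovar_of_not_dvd_index` (lit g12, `MatarNekovar2019/ShaVanishing.lean`,
p199938) turns the PUBLISHED named fact Matar–Nekovář, JTNB 31 (2019) Thm. 6.7 (1) — `p ≠ 2`, `E[p]`
IRREDUCIBLE (no surjectivity, no reduction-type, no `p ∤ D_K` hypothesis), Heegner field `K` for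
`N`, `(K, p) ≠ (ℚ(√−3), 3)`, `y_K ∉ pE(K)` ⇒ `Ш(E/K)[p^∞] = 0` — plus Gross–Zagier–Kolyvagin into
Miller's `BSD(E, p)` at a pair with `ord_p #Ш_an = 0` and `p ∤ [E(K) : ℤ y_K]`. At a pair of the
good-SUPERSINGULAR classes the irreducibility input is a THEOREM of the tree (Serre, Invent. Math.
15 (1972) §1.11 Prop. 12: `hasIrreducibleModPGaloisRep_of_dvd_frobeniusTrace`; on the classes:
`ClassX6.irr`, `ClassX7.irr`, `ClassX8.irr'` — harvest-1 g8, p196465 / p196563 / p196518), so the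
booking shape on these classes carries NO image input at all:

* `X6.bsdp_of_matarNekovar_of_not_dvd_index` (`p ≠ 2`; for `p = 3` the Heegner field must not
  be `ℚ(√−3)` — automatic when `3 ∣ N`, a hypothesis otherwise),
* `X7.bsdp_of_matarNekovar_of_not_dvd_index` (same),
* `X8.bsdp_of_matarNekovar_of_not_dvd_index` (`p = 3`: `d_K ≠ −3` explicit),
* and the typed residues `X6/X7/X8.MissingInputAt` at such a pair.

Census reach (hyp v3 §0.6 / `mn19_eligible.tsv`, N < 2·10⁴, `r = 1`): X8 7 ‖ 3 pairs and X7 1 ‖ 0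
pair meet every printed hypothesis on certified data — all at `p = 3` with the unit Heegner index
at a `3`-RAMIFIED Heegner field only (allowed by the printed statement: MN19 discharges Gross's
hidden `p ∤ D_K` through (C4), p. 498); the surjective-image rank-1 pairs of X6/X7/X8 already have
the lane's Kolyvagin route (`Typed.bsdp_of_kolyvagin_of_not_dvd_index`). Nothing booked here;
admissibility and the index-certificate engine bar are the referee's (R-MN19, lit MN19-READING §4).

References: A. Matar, J. Nekovář, J. Théor. Nombres Bordeaux 31 (2019) 455–501, Thm. 6.7 (1),
Prop. 5.26, Prop. 6.4–6.5; Correction, JTNB 33 (2021) 627–628; J.-P. Serre, Invent. Math. 15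
(1972) §1.11 Prop. 12; R. L. Miller, LMS J. Comput. Math. 14 (2011) §1; RESIDUAL-CASES.md §a.2
X6/X7/X8; CLASS-OWNERS.md rows X6–X8.
-/

noncomputable section

open scoped Classical

open WeierstrassCurve Literature.NumberTheory.EllipticCurves
  Literature.NumberTheory.EllipticCurves.Rank1Residual
  Literature.NumberTheory.EllipticCurves.Rank1Residual.Typed

namespace Summit.BirchSwinnertonDyer.Rank1Residual.Supersingular

variable (W : WeierstrassCurve ℚ) [W.IsElliptic] [W.IsGloballyMinimal] (p : ℕ) [hp : Fact p.Prime]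

/-! ## §1 Class X7 (good supersingular, `E` not semistable) -/

/-- **X7: `BSD(E,p)` from Matar–Nekovář 2019 Thm. 6.7 (1) and a Heegner index certificate, no
image input.** For an X7 pair `(E, p)` (`ClassX7 W p`: good supersingular at `p`, `E` not
semistable) with `p ≠ 2` and analytic rank `≤ 1`: granted the PUBLISHED named fact `hMN` and GZK,
the per-pair inputs are the Heegner field `K` (imaginary quadratic, Heegner hypothesis for `N`,
and `d_K ≠ −3` if `p = 3`), a Heegner point `P` of infinite order with `p ∤ [E(K) : ℤP]`, and
`#Ш_an = q` with `ord_p q = 0`. `irr(p)` is `ClassX7.irr` (Serre Prop. 12). Per pair; nothing booked.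
[cite: MatarNekovar2019, Thm. 6.7 (1) (p. 498), Prop. 6.4–6.5 (p. 498)] [cite: Serre1972, §1.11 Prop. 12] [cite: Miller2011LMS, §1 and Def. 1.1] -/
theorem X7.bsdp_of_matarNekovar_of_not_dvd_index
    (hGZK : rank_eq_analyticRank_of_analyticRank_le_one)
    {N : ℕ} [NeZero N] {K : Type} [Field K] [NumberField K]
    (hMN : MatarNekovar2019.thm67_sha_primary_trivial_of_irreducible N W K)
    (hX : ClassX7 W p) (hp2 : p ≠ 2) (hr : W.analyticRank ≤ 1)
    (hK : IsImaginaryQuadratic K) (hH : SatisfiesHeegnerHypothesis N K)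
    (h3 : p = 3 → NumberField.discr K ≠ -3)
    {P : (W.baseChange K).toAffine.Point} (hP : IsHeegnerPoint N W K P) (hnt : ¬ IsOfFinAddOrder P)
    (hI : ¬ p ∣ (AddSubgroup.zmultiples P).index)
    {q : ℚ} (hq : shaAn W = (q : ℂ)) (hv : padicValRat p q = 0) : BSDp W p :=
  Typed.bsdp_of_matarNekovar_of_not_dvd_index W p hGZK hMN hK hH hP hnt hp2 (ClassX7.irr W p hp2 hX)
    h3 hI hr hq hv

/-- … and X7's typed residue follows at such a pair. [cite: MatarNekovar2019, Thm. 6.7 (1) (p. 498)] [cite: Miller2011LMS, Def. 1.1] -/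
theorem X7.missingInputAt_of_matarNekovar_of_not_dvd_index
    (hGZK : rank_eq_analyticRank_of_analyticRank_le_one)
    {N : ℕ} [NeZero N] {K : Type} [Field K] [NumberField K]
    (hMN : MatarNekovar2019.thm67_sha_primary_trivial_of_irreducible N W K)
    (hX : ClassX7 W p) (hp2 : p ≠ 2) (hr : W.analyticRank ≤ 1)
    (hK : IsImaginaryQuadratic K) (hH : SatisfiesHeegnerHypothesis N K)
    (h3 : p = 3 → NumberField.discr K ≠ -3)
    {P : (W.baseChange K).toAffine.Point} (hP : IsHeegnerPoint N W K P) (hnt : ¬ IsOfFinAddOrder P)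
    (hI : ¬ p ∣ (AddSubgroup.zmultiples P).index)
    {q : ℚ} (hq : shaAn W = (q : ℂ)) (hv : padicValRat p q = 0) : X7.MissingInputAt W p := by
  obtain ⟨-, hfin⟩ := hGZK W hr
  haveI : Finite W.sha := hfin
  have hB := X7.bsdp_of_matarNekovar_of_not_dvd_index W p hGZK hMN hX hp2 hr hK hH h3 hP hnt hI hq hv
  have hPP := missingPPartAt_of_bsdp W p hB
  exact ⟨fun _ _ _ ↦ (lower_and_upper_of_missingPPartAt W p hPP).1, fun _ ↦ hPP⟩

/-! ## §2 Class X8 (`p = 3` good supersingular, `a_3 = ±3`) -/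

/-- **X8: `BSD(E,3)` from Matar–Nekovář 2019 Thm. 6.7 (1) and a Heegner index certificate, no
image input** (`ClassX8 W p`: `p = 3`, good supersingular at `3`, `a_3 ≠ 0`; `irr(3)` is
`ClassX8.irr'`). The Heegner field must satisfy `d_K ≠ −3` (the theorem's `(K, p) ≠ (ℚ(√−3), 3)`).
On the census (hyp `mn19_eligible.tsv`) the 7 ‖ 3 eligible X8 pairs have their unit index at a
`3`-ramified `K` — allowed as printed. Per pair; nothing booked.
[cite: MatarNekovar2019, Thm. 6.7 (1) (p. 498), Prop. 6.4–6.5 (p. 498)] [cite: Serre1972, §1.11 Prop. 12] [cite: Miller2011LMS, §1 and Def. 1.1] -/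
theorem X8.bsdp_of_matarNekovar_of_not_dvd_index
    (hGZK : rank_eq_analyticRank_of_analyticRank_le_one)
    {N : ℕ} [NeZero N] {K : Type} [Field K] [NumberField K]
    (hMN : MatarNekovar2019.thm67_sha_primary_trivial_of_irreducible N W K)
    (hX : ClassX8 W p) (hr : W.analyticRank ≤ 1)
    (hK : IsImaginaryQuadratic K) (hH : SatisfiesHeegnerHypothesis N K)
    (h3 : NumberField.discr K ≠ -3)
    {P : (W.baseChange K).toAffine.Point} (hP : IsHeegnerPoint N W K P) (hnt : ¬ IsOfFinAddOrder P)
    (hI : ¬ p ∣ (AddSubgroup.zmultiples P).index)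
    {q : ℚ} (hq : shaAn W = (q : ℂ)) (hv : padicValRat p q = 0) : BSDp W p :=
  Typed.bsdp_of_matarNekovar_of_not_dvd_index W p hGZK hMN hK hH hP hnt
    (by rw [hX.1]; decide) (ClassX8.irr' W p hX) (fun _ ↦ h3) hI hr hq hv

/-- … and X8's typed residue follows at such a pair. [cite: MatarNekovar2019, Thm. 6.7 (1) (p. 498)] [cite: Miller2011LMS, Def. 1.1] -/
theorem X8.missingInputAt_of_matarNekovar_of_not_dvd_index
    (hGZK : rank_eq_analyticRank_of_analyticRank_le_one)
    {N : ℕ} [NeZero N] {K : Type} [Field K] [NumberField K]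
    (hMN : MatarNekovar2019.thm67_sha_primary_trivial_of_irreducible N W K)
    (hX : ClassX8 W p) (hr : W.analyticRank ≤ 1)
    (hK : IsImaginaryQuadratic K) (hH : SatisfiesHeegnerHypothesis N K)
    (h3 : NumberField.discr K ≠ -3)
    {P : (W.baseChange K).toAffine.Point} (hP : IsHeegnerPoint N W K P) (hnt : ¬ IsOfFinAddOrder P)
    (hI : ¬ p ∣ (AddSubgroup.zmultiples P).index)
    {q : ℚ} (hq : shaAn W = (q : ℂ)) (hv : padicValRat p q = 0) : X8.MissingInputAt W p := by
  obtain ⟨-, hfin⟩ := hGZK W hr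
  haveI : Finite W.sha := hfin
  have hB := X8.bsdp_of_matarNekovar_of_not_dvd_index W p hGZK hMN hX hr hK hH h3 hP hnt hI hq hv
  have hPP := missingPPartAt_of_bsdp W p hB
  exact ⟨fun _ _ ↦ (lower_and_upper_of_missingPPartAt W p hPP).1, fun _ ↦ hPP⟩

/-! ## §3 Class X6 (good supersingular, `E` semistable) -/

/-- **X6: `BSD(E,p)` from Matar–Nekovář 2019 Thm. 6.7 (1) and a Heegner index certificate, no
image input** (`ClassX6 W p`; `irr(p)` is `ClassX6.irr`). In rank one this is a flag-free
alternative, per pair, to the Jetchev–Skinner–Wan route (`X6.missingInputAt_of_analyticRank_eq_one'`,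
census flag `JSW-ss`). Per pair; nothing booked.
[cite: MatarNekovar2019, Thm. 6.7 (1) (p. 498), Prop. 6.4–6.5 (p. 498)] [cite: Serre1972, §1.11 Prop. 12] [cite: Miller2011LMS, §1 and Def. 1.1] -/
theorem X6.bsdp_of_matarNekovar_of_not_dvd_index
    (hGZK : rank_eq_analyticRank_of_analyticRank_le_one)
    {N : ℕ} [NeZero N] {K : Type} [Field K] [NumberField K]
    (hMN : MatarNekovar2019.thm67_sha_primary_trivial_of_irreducible N W K)
    (hX : ClassX6 W p) (hp2 : p ≠ 2) (hr : W.analyticRank ≤ 1)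
    (hK : IsImaginaryQuadratic K) (hH : SatisfiesHeegnerHypothesis N K)
    (h3 : p = 3 → NumberField.discr K ≠ -3)
    {P : (W.baseChange K).toAffine.Point} (hP : IsHeegnerPoint N W K P) (hnt : ¬ IsOfFinAddOrder P)
    (hI : ¬ p ∣ (AddSubgroup.zmultiples P).index)
    {q : ℚ} (hq : shaAn W = (q : ℂ)) (hv : padicValRat p q = 0) : BSDp W p :=
  Typed.bsdp_of_matarNekovar_of_not_dvd_index W p hGZK hMN hK hH hP hnt hp2 (ClassX6.irr W p hp2 hX)
    h3 hI hr hq hv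

/-- … and X6's typed residue follows at such a pair. [cite: MatarNekovar2019, Thm. 6.7 (1) (p. 498)] [cite: Miller2011LMS, Def. 1.1] -/
theorem X6.missingInputAt_of_matarNekovar_of_not_dvd_index
    (hGZK : rank_eq_analyticRank_of_analyticRank_le_one)
    {N : ℕ} [NeZero N] {K : Type} [Field K] [NumberField K]
    (hMN : MatarNekovar2019.thm67_sha_primary_trivial_of_irreducible N W K)
    (hX : ClassX6 W p) (hp2 : p ≠ 2) (hr : W.analyticRank ≤ 1)
    (hK : IsImaginaryQuadratic K) (hH : SatisfiesHeegnerHypothesis N K)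
    (h3 : p = 3 → NumberField.discr K ≠ -3)
    {P : (W.baseChange K).toAffine.Point} (hP : IsHeegnerPoint N W K P) (hnt : ¬ IsOfFinAddOrder P)
    (hI : ¬ p ∣ (AddSubgroup.zmultiples P).index)
    {q : ℚ} (hq : shaAn W = (q : ℂ)) (hv : padicValRat p q = 0) : X6.MissingInputAt W p := by
  obtain ⟨-, hfin⟩ := hGZK W hr
  haveI : Finite W.sha := hfin
  have hB := X6.bsdp_of_matarNekovar_of_not_dvd_index W p hGZK hMN hX hp2 hr hK hH h3 hP hnt hI hq hv
  have hPP := missingPPartAt_of_bsdp W p hB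
  exact ⟨fun _ _ _ ↦ (lower_and_upper_of_missingPPartAt W p hPP).1, fun _ ↦ hPP⟩

/-! ## §4 Any good supersingular pair (class-free form) -/

/-- **Good supersingular `p ≠ 2`, any `E`: the Matar–Nekovář booking shape with `irr(p)` from
Serre Prop. 12** (`GoodSS W p`: good reduction, `p ∣ a_p`). The common content of §1–§3.
[cite: MatarNekovar2019, Thm. 6.7 (1) (p. 498)] [cite: Serre1972, §1.11 Prop. 12] [cite: Miller2011LMS, §1 and Def. 1.1] -/
theorem bsdp_of_goodSS_of_matarNekovar_of_not_dvd_index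
    (hGZK : rank_eq_analyticRank_of_analyticRank_le_one)
    {N : ℕ} [NeZero N] {K : Type} [Field K] [NumberField K]
    (hMN : MatarNekovar2019.thm67_sha_primary_trivial_of_irreducible N W K)
    (hss : GoodSS W p) (hp2 : p ≠ 2) (hr : W.analyticRank ≤ 1)
    (hK : IsImaginaryQuadratic K) (hH : SatisfiesHeegnerHypothesis N K)
    (h3 : p = 3 → NumberField.discr K ≠ -3)
    {P : (W.baseChange K).toAffine.Point} (hP : IsHeegnerPoint N W K P) (hnt : ¬ IsOfFinAddOrder P)
    (hI : ¬ p ∣ (AddSubgroup.zmultiples P).index)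
    {q : ℚ} (hq : shaAn W = (q : ℂ)) (hv : padicValRat p q = 0) : BSDp W p :=
  Typed.bsdp_of_matarNekovar_of_not_dvd_index W p hGZK hMN hK hH hP hnt hp2
    (hasIrreducibleModPGaloisRep_of_dvd_frobeniusTrace W p hp2
      (W.not_dvd_minimalDiscriminantInt_of_hasGoodReductionAtPrime' p hss.1) hss.2)
    h3 hI hr hq hv

end Summit.BirchSwinnertonDyer.Rank1Residual.Supersingular

end
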